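import Summits.Ventures.CertifiedQuantumChemistry.Statement
import HarnessLib

/-!
# Ventures/CertifiedQuantumChemistry — Hamiltonians/Tables.lean: literal models from canonical integral tables

HONEST FRAMING (verbatim): certified bounds for a stated model Hamiltonian in a stated basis; not a
claim about the real molecule beyond that model.

A literal `Model k` (ruling K3: only `k ≤ 10`-class files) is written as two association lists keyed
exactly like the MODEL PIN's canonical JSON (`FORMAT-pin1.md`, `qchem-modelpin/1`; reader A
`code/qchem_rdm_a/fcidump_exact.py::canon_eri_key`): one-electron integrals by the SORTED pair
`(min p q, max p q)`, two-electron integrals `(pq|rs)` by the canonical representative of the 8-fold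
orbit of real orbitals — sort each pair, then order the two pairs lexicographically. `Model.ofTables`
turns such tables (0-based orbital indices, absent key = 0) into a `Model k`; by construction it is
`IsSymmetric` (`Model.ofTables_isSymmetric`: both symmetries used by `molecularHamiltonian_isHermitian`
fix the canonical keys), so `Certificates/` files discharge the symmetry hypothesis of the soundness
theorems by this lemma instead of a `decide` over `k⁴` entries. The typer's generator
(`gen_model_lean.py`) emits the tables from the integral FILE read exactly (every decimal literal as the
rational it prints), asserts that all printed symmetry copies agree, and records `fcidump_sha256` /
`model_sha256` in the docstring of the emitted `Hamiltonians/<Name>.lean`.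
-/

namespace Summit.Ventures.CertifiedQuantumChemistry

/-- Sorted pair key `(min p q, max p q)` (the pin's key of `h_pq` and of each index pair of `(pq|rs)`). -/
def pairKey (p q : ℕ) : ℕ × ℕ := if p ≤ q then (p, q) else (q, p)

/-- `pairKey` is symmetric. -/
theorem pairKey_comm (p q : ℕ) : pairKey p q = pairKey q p := by
  unfold pairKey
  split_ifs with h1 h2 h2
  · have : p = q := Nat.le_antisymm h1 h2
    subst this; rfl
  · rfl
  · rfl
  · omega

/-- Strict-then-weak lexicographic comparison of pairs of naturals (as a `Bool`, total). -/
def pairLE (a b : ℕ × ℕ) : Bool := decide (a.1 < b.1) || (decide (a.1 = b.1) && decide (a.2 ≤ b.2))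

/-- Canonical 8-fold key of `(pq|rs)` for real orbitals: sort `(p,q)` and `(r,s)`, then put the
lexicographically smaller pair first (= `canon_eri_key` of reader A / the pin's `eri` key). -/
def quadKey (p q r s : ℕ) : (ℕ × ℕ) × (ℕ × ℕ) :=
  if pairLE (pairKey p q) (pairKey r s) then (pairKey p q, pairKey r s) else (pairKey r s, pairKey p q)

/-- The Hermitian symmetry `(pq|rs) ↔ (qp|sr)` fixes the canonical key. -/
theorem quadKey_swap (p q r s : ℕ) : quadKey p q r s = quadKey q p s r := by
  simp only [quadKey, pairKey_comm q p, pairKey_comm s r]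

/-- The exact rational `z / n` of a table entry stored as an (integer numerator, natural denominator)
pair — integral files print decimals, so every entry is such a pair; storing the pair keeps the literal
tables cheap to elaborate (`mkRat` normalises). -/
def entryVal (e : ℤ × ℕ) : ℚ := mkRat e.1 e.2

/-- `entryVal (z, n) = z / n`. -/
theorem entryVal_eq_div (z : ℤ) (n : ℕ) : entryVal (z, n) = (z : ℚ) / (n : ℚ) := by
  simp [entryVal, Rat.mkRat_eq_div]

namespace Model

/-- A literal model from canonical tables: `hT` keyed by `pairKey`, `eT` keyed by `quadKey` (0-based
indices; values as (numerator, denominator) pairs; keys absent from the lists are integrals equal to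
`0`), plus the scalar `ecore`. -/
def ofTables (k : ℕ) (hT : List ((ℕ × ℕ) × (ℤ × ℕ))) (eT : List (((ℕ × ℕ) × (ℕ × ℕ)) × (ℤ × ℕ)))
    (ecore : ℚ) : Model k where
  h p q := ((hT.lookup (pairKey p.val q.val)).map entryVal).getD 0
  eri p q r s := ((eT.lookup (quadKey p.val q.val r.val s.val)).map entryVal).getD 0
  ecore := ecore

/-- A model given by canonical tables is symmetric (hence its Hamiltonian is Hermitian). -/
theorem ofTables_isSymmetric (k : ℕ) (hT : List ((ℕ × ℕ) × (ℤ × ℕ)))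
    (eT : List (((ℕ × ℕ) × (ℕ × ℕ)) × (ℤ × ℕ))) (ecore : ℚ) : (ofTables k hT eT ecore).IsSymmetric := by
  refine ⟨fun p q => ?_, fun p q r s => ?_⟩
  · simp only [ofTables, pairKey_comm p.val q.val]
  · simp only [ofTables, quadKey_swap p.val q.val r.val s.val]

/-- Hermiticity of the Hamiltonian of a table model. -/
theorem ofTables_hamiltonian_isHermitian (k : ℕ) (hT : List ((ℕ × ℕ) × (ℤ × ℕ)))
    (eT : List (((ℕ × ℕ) × (ℕ × ℕ)) × (ℤ × ℕ))) (ecore : ℚ) :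
    (ofTables k hT eT ecore).hamiltonian.IsHermitian :=
  hamiltonian_isHermitian (ofTables_isSymmetric k hT eT ecore)

end Model

end Summit.Ventures.CertifiedQuantumChemistry
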